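import Mathlib
import HarnessLib
import Summits.MatrixMultiplication.Statement
import Literature.Computability.AlgebraicComplexity.MatrixMultiplicationExponent

/-!
Route: OrbitEntropy

CLOSED (retired) 2026-08-15T13:49:01Z by operator:999:1257524 — reason: not-a-thesis: assembly does not conclude the sub-problem Statement — note: D-0027 §2.1 audit (human 2026-08-15: routes that do not decide the summit are removed): the assembly concludes `BoundedOrbitExponentGap`, not the sub-problem statement; a NEW conforming route may be opened from the same idea (generated `closes : … → _root_.MatrixMultiplication`).. The file is kept as the record of this route; refuted decls are indexed as negative knowledge (`ledger negatives`).

# Route OrbitEntropy — symmetry is paid in orbits — bounded-orbit designs of ⟨n,n,n⟩ cannot reach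
exponent 2 (orbit–savings law r ≥ n³·2^(−k/c))

REGIME ROUTE OF THE NEGATIVE SUMMIT (realises card reynolds-orbit-entropy, its only card). Objects:
an H-DESIGN of ⟨n,n,n⟩ with r
terms and at most k SEED ORBITS is a decomposition matMulTensor ℂ n n n = Σ_{j<r} w_j⊗u_j⊗v_j
together with a finite group H acting
linearly on the three legs (three representations on Fin n × Fin n → ℂ) and on the labels (π : H →*
Perm(Fin r)) so that the triads are
permuted equivariantly (h·t_j = t_{π(h)j}), and k labels whose H-orbits cover all r (then H fixes
⟨n,n,n⟩ automatically; every algorithm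
is a design for H = 1 with k = r; cost r = Σ_j [H : Stab(seed_j)]; Reynolds form ⟨n,n,n⟩ = R_H(S),
rank S ≤ k). Target X =
BoundedOrbitExponentGap: for every k there are δ > 0 and n₀ such that every H-design of ⟨n,n,n⟩, n ≥
n₀, with ≤ k seed orbits has
r ≥ n^(2+δ) — "no bounded family of seed orbits multiplies matrices in exponent 2". X is an INSTANCE
FAMILY of ¬(ω = 2): ω(ℂ) > 2 → X
(support OmegaGtTwoFrame, PROVED in Sketch.lean from two_le_omega and n^ω ≤ R(⟨n,n,n⟩)),
equivalently ¬X → ω(ℂ) = 2; X → ¬(ω = 2) is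
NOT claimed. It suffices to show the card's ORBIT–SAVINGS LAW (crux OrbitSavingsLaw: one absolute c
> 0 with r ≥ n³·2^(−k/c) for
every finite H, every n, k): Assembly OrbitSavingsLaw → X is real arithmetic (PROVED in
Sketch.lean).
Lean: `∀ k : ℕ, ∃ δ : ℝ, 0 < δ ∧ ∃ n₀ : ℕ, ∀ (n r : ℕ), n₀ ≤ n → ∀ (H : Type) [Group H] [Finite H]
(ρA ρB ρC : Representation ℂ H (Fin n × Fin n → ℂ)) (π : H →* Equiv.Perm (Fin r)) (w u v : Fin r →
Fin n × Fin n → ℂ), Literature.Computability.AlgebraicComplexity.matMulTensor ℂ n n n = ∑ j,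
Literature.Computability.AlgebraicComplexity.triad (w j) (u j) (v j) → (∀ (h : H) (j : Fin r),
Literature.Computability.AlgebraicComplexity.triad (ρA h (w j)) (ρB h (u j)) (ρC h (v j)) =
Literature.Computability.AlgebraicComplexity.triad (w (π h j)) (u (π h j)) (v (π h j))) → (∃ s : Fin
k → Fin r, ∀ j : Fin r, ∃ (i : Fin k) (h : H), π h (s i) = j) → (n : ℝ) ^ (2 + δ) ≤ (r : ℝ)`

## Assembly
Pure real arithmetic (PROVED in Sketch.lean, sorry-free): given k, take δ = 1/2 and n₀ > 2^(2k/c);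
for n ≥ n₀, n^(1/2) ≥ 2^(k/c), so
n^(2+1/2) = n³·n^(−1/2) ≤ n³·2^(−k/c) ≤ r by OrbitSavingsLaw. The chain ends in the route's Target
(regime route, as
HodgeConjecture/EvenB2Twistor): Target is implied by ¬(ω(ℂ) = 2) (OmegaGtTwoFrame) and does not
imply it; the cruxes ranked 3–5 are the
law's typed special cases (milestones, not formal hypotheses of the assembly).

Rationale: WHY THIS LINE. Grochow–Moore (arXiv:1612.01527 §3–§4, arXiv:1708.09398 §4) rediscovered Strassen as
1 + one S_3-orbit and built 1 + one G-orbit designs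
of rank n³ − n + 1 for all n, observing (§3, p.5) that an orbit sum kills every non-trivial isotypic
component — i.e. a k-orbit design exists
iff the H-invariant projection (Reynolds image) of a rank-≤k tensor is ⟨n,n,n⟩ — and hoping (§4)
that multi-orbit designs become optimal;
fifty years of symmetric constructions (CILO arXiv:1610.08364, BILR arXiv:1801.00843, Burichenko
arXiv:2211.06485 Thm 2 / Prop 5, flip
graphs with symmetry arXiv:2502.04514) land at n³ − lower order or need orbit counts growing like
log n (Strassen^⊗m: m+1 orbits, 7^m
terms). The card turns this census into a LAW — every halving of the multiplication count costs a
new seed orbit, r ≥ n³·2^(−k/c) — and this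
route makes it a two-layer programme: the law (all finite H) on top; below it the k ≤ 2 case for all
H (the GM regime), the abelian case
(weight-zero / additive structure of the Reynolds image), and the permutation cases, which are
theorems in reach — for the FULL index
symmetry S_n³ the planner's small-index lemma (index < n³ in S_n³ forces an alternating factor) plus
an alternating trilinear functional
gives r ≥ n³ exactly (support IndexPermutationCubic), and for diagonal relabelling S_n
Dixon–Mortimer 5.2B plus the partition-algebra
span certificate of card representation-stability-barrier gives r ≥ C(n,3). Imported areas: finite
permutation groups (small-index
subgroups, Jordan-type structure), invariant theory of S_n / partition algebras (Reynolds images),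
additive combinatorics for the abelian
case; no rank/flattening method anywhere (the class is restricted, the bounds are cubic). What no
route does: SchurWeylEquivariant and
StabilizerTensorRank BET on symmetric/seeded constructions (their negative cruxes concern one
specific H each, with no orbit count);
this line is the converse cost law for ALL finite H, quantified in the number of seed orbits, and
its typed sub-cases are directly usable
as refuter ammunition against bounded-seed cruxes (e.g. "one seed triple + a subgroup of isotropies"
designs). Negatives index: empty.

RANKED CRUXES. #0 BoundedOrbitExponentGap (target) — for every k there are δ > 0 and n₀ such that
for all n ≥ n₀ every H-design of ⟨n,n,n⟩ (any finite group H, any linear leg actions, equivariant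
labels) whose labels are covered by ≤ k seed orbits has at least n^(2+δ) terms. Implied by ω(ℂ) > 2
(OmegaGtTwoFrame) and by OrbitSavingsLaw (Assembly); its negation implies ω(ℂ) = 2. (why it might
fail: false only if ONE fixed orbit budget k reaches exponent 2 + o(1) along a sequence of n — which
would prove ω = 2 outright; conceivable solely via conjugation-type designs whose symmetry is free
(GM16 §4 hopes), none known below n³ − n + 1.) [arXiv:1612.01527, arXiv:1708.09398,
arXiv:2211.06485, Blaser2013]
#2 OrbitSavingsLaw (crux) — the ORBIT–SAVINGS LAW (card item X / P3): there is an absolute c > 0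
such that for every n, k, every finite group H and every H-design of ⟨n,n,n⟩ with ≤ k seed orbits, r
≥ n³·2^(−k/c) (equivalently k ≥ c·log₂(n³/r): savings n^(3−δ) need ≥ c·δ·log₂ n seed orbits).
Vacuous at H = 1 (k = r); Strassen towers force c ≤ 1/log₂(8/7) ≈ 5.19 (StrassenTowerCalibration);
the linear formalisation (H → GL(A)×GL(B)×GL(C)) loses only a factor 6 in k against the full
isotropy group with its S_3 part. [difficulty: open-problem] (why it might fail: one bounded-orbit
family with polynomial savings n^(3−δ) kills it — e.g. a multi-orbit conjugation design of the kind
GM16 §4 hopes for, or a Clifford-orbit design at n = 2^m; even k = 2 below n³ − n + 1 is open for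
irreducible H.) [arXiv:1612.01527, arXiv:1708.09398, arXiv:2211.06485, arXiv:1801.00843,
arXiv:1610.08364]
#3 TwoOrbitDesignsCubic (crux) — the first all-H case (the Grochow–Moore regime, card P3 at k ≤ 2):
there is c > 0 such that every H-design of ⟨n,n,n⟩ (any finite H) whose labels are covered by at
most two seed orbits has r ≥ c·n³. Data: standard algorithm k = 1, r = n³; GM16 §4: 1 + one orbit, r
= n³ − n + 1 for all n; Strassen 1 + 6 (c ≤ 7/8). Planner's remark (NOTES.md): transitive (k = 1)
designs are PLENTIFUL — for every finite irreducible G ≤ GL_n the G³-invariants of A⊗B⊗C are the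
line of ⟨n,n,n⟩ (Schur), so the G³-orbit sum of ANY seed a⊗b⊗c with tr(abc) ≠ 0 is a multiple of
⟨n,n,n⟩ and, rescaled, a one-orbit design of cost [G³ : Stab(seed)]; the crude bound [G : Stab_G(W)]
≥ n/dim W for subspace stabilisers gives r ≥ n³/(rk a · rk b · rk c) (so rank-one seeds never beat
n³ and full-rank seeds cost ≥ |G|² ≥ n⁴): the open regime is seeds of intermediate leg rank with
large stabilisers, and diagonal (non-product) H as in GM. Tools foreseen: leg-rank profiles are
constant on orbits; subspace-orbit counting; Jordan/Collins + Clifford theory to pass from H to a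
product-like normal subgroup. [difficulty: L] (why it might fail: a seed of intermediate leg rank d
with subspace stabilisers of index ~n/d in an irreducible G (monomial, S_(n+1), extraspecial at n =
2^m) could give a transitive G³-design of cost ~(n/d)³·(overhead) = o(n³); GM17 §4 proves optimality
only inside the 2-design ansatz.) [arXiv:1612.01527, arXiv:1708.09398, arXiv:2211.06485]
#4 AbelianDesignLaw (crux) — the law for ABELIAN H (card P2): there is c > 0 such that every design
of ⟨n,n,n⟩ for a finite abelian group H (torsion tori, modulation groups Z_n², cyclic groups; three
commuting diagonalisable leg actions) with ≤ k seed orbits has r ≥ n³·2^(−k/c). Mechanism: for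
abelian H the Reynolds image of a triad is its weight-zero part Σ_{λ+μ+ν=0} a_λ⊗b_μ⊗c_ν, so a k-seed
design is an additive covering of the MaMu support with cocycle phases by k sumset-shaped pieces;
Burichenko's cyclic-orbit reduction (arXiv:2211.06485 Prop 9) is the embryo, the
op-norm/character-sum bound of card symplectic-sqrt-cancellation-modulation-nogo (≥ n^(1/2) orbits
for 1-bounded modulation seeds) the first quantitative instance. [difficulty: L] (why it might fail:
seeds with unbounded dynamic range escape every character-sum bound known (the modulation no-go
needs 1-bounded unit-weight seeds); a bounded family of Bohr-set-supported seeds might tile the MaMu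
support with cancellation for H = Z_n² or a torsion torus.) [arXiv:2211.06485, arXiv:1612.01527,
arXiv:math/0307321, arXiv:1207.6528]
#5 DiagonalRelabellingCubic (crux) — the CILO/BILR "standard symmetry" case (card P1): for n ≥ n₀
every decomposition of ⟨n,n,n⟩ stable under simultaneous relabelling of all indices by S_n (σ acting
diagonally on rows and columns of all three legs, labels permuted by a hom π) has at least C(n,3) =
n(n−1)(n−2)/6 terms — for every orbit count k. Route: r < C(n,3) ⇒ every label stabiliser has index
< C(n,3) in S_n ⇒ contains Alt([n]∖Δ), |Δ| ≤ 2 (Dixon–Mortimer Thm 5.2B) ⇒ each leg is fixed by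
A_(n−2) (perfectness kills characters) ⇒ legs lie in the 10-dimensional "≤ 2 labels" space ⇒ the
terms lie in the span of ≤2-label orbit sums inside the 203-dimensional S_n-invariants of (ℂ^n)^⊗6,
which misses the MaMu invariant x_{16|23|45}+… (span rank 195/203, certificate of card
representation-stability-barrier, exact at n = 50, 1000; symbolic-n version needed). [difficulty: M]
(why it might fail: the 195/203 span certificate is numeric at n = 50, 1000; a symbolic-n proof
could expose sporadic n where the MaMu invariant enters the 2-label span (hence ∃ n₀), and
Dixon–Mortimer 5.2B in Lean is a real formalisation project.) [doi:10.1007/978-1-4612-0731-3,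
arXiv:1204.4533, arXiv:1610.08364, arXiv:1801.00843]
#9 IndexPermutationCubic (support) — FULL index symmetry buys nothing: for n ≥ 6 every decomposition
of ⟨n,n,n⟩ stable under the whole index-permutation isotropy S_n × S_n × S_n ((σ,τ,υ) relabelling
the row index i, the summation index j and the column index k in all legs at once, labels permuted
by a hom π) has at least n³ terms (tight: the standard algorithm, StandardOneOrbit) — for every
orbit count. Proof (planner, NOTES.md): (a) LEMMA: G ≤ S_n³ of index < n³ contains a full
alternating factor 1×A_n×1 in some coordinate (K_x := G ∩ factor_x is normal in G, so |G| ≤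
|N(K_i)|·|N(K_j)|·|K_k|; if no K_x ⊇ A_n then two coordinates have N(K_x) ⊇ A_n, forcing K_x = 1,
and G ∩ (S_n × S_n × 1) is a graph, so [S_n³ : G] ≥ n! > n³); (b) r < n³ ⇒ each label stabiliser
contains some 1×A_n(x)×1 ⇒ by equivariance and 1-transitivity/perfectness of A_n the term is
constant along index x in both legs carrying x ⇒ it is killed by the trilinear functional φ(X) = Σ
ε(i,i′)ε(j,j′)ε(k,k′)·X((i,k),(i′,j),(j′,k′)), ε(x,x′) = n[x=x′] − 1, whereas φ(⟨n,n,n⟩) = n³(n−1)³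
≠ 0. Uses alternatingGroup.isSimpleGroup (Mathlib). [difficulty: provable-now] [Blaser2013,
doi:10.1007/978-1-4612-0731-3, arXiv:1610.08364]
#9 StandardOneOrbit (support) — calibration of the design predicate: the standard algorithm
Σ_{i,j,k} e_(i,k)⊗e_(i,j)⊗e_(j,k) is a ONE-orbit design under S_n × S_n × S_n (labels Fin (n³) ≃
triples (i,j,k), permuted coordinatewise), so IndexPermutationCubic is tight and OrbitSavingsLaw
needs 2^(−1/c) ≤ 1 only. [difficulty: provable-now] [Blaser2013, arXiv:1612.01527]
#9 StrassenTowerCalibration (support) — calibration from above (the law is sharp in SHAPE): for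
every m the m-th Kronecker power of Strassen's decomposition, in the Grochow–Moore form 1 + one
S_3-orbit of six terms (arXiv:1708.09398), is a design of ⟨2^m,2^m,2^m⟩ with 7^m terms and at most
m+1 seed orbits under the finite group S_3 ≀ S_m (S_3 by simultaneous conjugation in each Kronecker
slot, S_m permuting slots) — the orbit of a term is its number of identity slots. Consequence: any
admissible c in OrbitSavingsLaw satisfies 8^m·2^(−(m+1)/c) ≤ 7^m for all m, i.e. c ≤ 1/log₂(8/7) ≈
5.19. [difficulty: M] [Strassen1969, arXiv:1708.09398, arXiv:1612.01527, arXiv:1408.6273]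
#9 OmegaGtTwoFrame (support) — the frame recording that the target is an instance family of the
NEGATIVE summit: if ω(ℂ) ≠ 2 then (two_le_omega) ω(ℂ) = 2 + δ with δ > 0, and every design is in
particular a decomposition, so r ≥ R(⟨n,n,n⟩) ≥ n^ω (rpow_omega_le_tensorRank_matMulTensor, n ≥ 2) =
n^(2+δ): ¬MatrixMultiplication → BoundedOrbitExponentGap, uniformly in k. PROVED in the planner's
Sketch.lean (sorry-free); its contrapositive says a bounded-orbit family of exponent 2 would prove
the summit. [difficulty: provable-now] [Blaser2013, arXiv:1612.01527]

TWO-LAYER PLAN. Foreseen glued splits, nothing filed now: OrbitSavingsLaw ⇐ JordanReduction →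
NormalAbelianCase → OrbitSavingsLaw (JordanReduction: a
finite H ≤ PGL_n³ has an abelian normal N with H/N acting through a bounded-degree permutation-like
quotient on the N-weight spaces —
Jordan/Collins + Clifford theory; NormalAbelianCase: the law for R_N followed by a bounded average,
i.e. AbelianDesignLaw with H/N-equivariance);
TwoOrbitDesignsCubic ⇐ TransitiveCase (k = 1: ⟨n,n,n⟩ proportional to one orbit sum) → OnePlusOrbit
(GM shape 1 + orbit) → TwoOrbitDesignsCubic;
AbelianDesignLaw ⇐ MonomialSeeds (seeds that are weight vectors: support counting, r ≥ n³/max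
support) → BoundedWeightSupport → AbelianDesignLaw.

KILL CRITERIA. OrbitSavingsLaw refuted (for every c a design with r < n³·2^(−k/c): concretely a
bounded-orbit family with savings n^(3−δ), or an
o(log n)-orbit family with polynomial savings) ⇒ route BROKEN; repair = restate to the surviving
regime (TwoOrbitDesignsCubic /
AbelianDesignLaw / permutation groups) if the witness is special, else close
`refuted:OrbitSavingsLaw` with the census "symmetry buys
super-constant savings per orbit" — itself a new algorithm scheme worth a positive card.
TwoOrbitDesignsCubic refuted by an explicit
2-orbit family with r = o(n³) refutes the law as well (same close). BoundedOrbitExponentGap refuted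
⇒ ω(ℂ) = 2 (OmegaGtTwoFrame,
contrapositive): the summit is proved and every route is moot. ω(ℂ) > 2 proved elsewhere
(BorderRankLowerBound, NilCoxeterShadow) proves
the Target for free but leaves the law and its sub-cases meaningful (they are cubic, not n^ω,
bounds); ω = 2 proved elsewhere leaves
the whole route meaningful as structure theory but demotes it to low priority.

NOT DECOMPOSED YET. The Jordan/Clifford reduction of general H to a normal abelian subgroup (layer-2
child of OrbitSavingsLaw); the S_3 (leg-permuting,
transpose) part of the isotropy group — the linear formalisation costs at most a factor 6 in k; the
exact constant for diagonal
relabelling (is n³/6 + O(n²) attained by an S_3-symmetric 3-label template? — card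
representation-stability-barrier B3); arbitrary
SUBGROUPS of S_n³ (between DiagonalRelabellingCubic and IndexPermutationCubic: plausible r ≥ c·n³
for all of them, subgroup zoo not
opened); twisted designs (orbit sums with characters χ(h), i.e. relative invariants — the natural
home of Clifford-orbit designs with
signs) — the law is conjectured for them too but not filed; a named definition `IsOrbitDesign n k r`
(the inlined predicate) to be
requested at the first split; the Reynolds-operator bookkeeping identity itself (definitional here:
orbit sum = index · average).

CHEAPEST FALSIFIER. A finite search the card already names, sharpened: for n ∈ {4, 5, 6} and k ≤ 3,
and H running over the maximal finite subgroups of the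
isotropy group of small index type — S_(n+1) and A_(n+1) in the n-dimensional irrep (GM), the
monomial groups G(m,1,n) ∩ isotropy for
m ≤ 4, the Heisenberg–Weyl image Z_n² ⋊ SL_2(Z_n), and for n = 4 the wreath S_3 ≀ S_2 and the
Clifford group — solve the Reynolds system
"R_H(s_1 + s_2 + s_3) = ⟨n,n,n⟩ with prescribed stabilisers" (unknowns: 3 seeds = 9 matrices;
equations: dim (A⊗B⊗C)^H, a few hundred)
by Gröbner/numerical algebraic geometry, and report the least cost Σ[H:Stab_i]. Any hit with r ≤
0.8·n³ refutes TwoOrbitDesignsCubic's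
spirit at k = 3 and calibrates c; a hit with r = o(n³)-shaped scaling across n = 4,5,6 kills the
line. Not run this session (plancard,
one-shot); by hand: GM's census (n³ − n + 1 at k = 2 for S_(n+1), A_5) and Strassen ⊗ standard
((7/8)n³ at k = 2) are the current minima.

NUMBERS. k = 1: standard algorithm r = n³ (S_n³, StandardOneOrbit); Weyl–Heisenberg presentation r =
n⁴; regular abelian TPP designs r = |G| ≥ n³
(CU03 abelian bound = the k = 1 law for that family). k = 2: Strassen 7 = 1 + 6 (S_3,
arXiv:1708.09398); GM16 §4: n³ − n + 1 for all n
(|G| = n³ − n; 25 and 61 at n = 3, 4 vs records 23, 48/49); Strassen ⊗ standard: (7/8)n³. k = m+1: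
Strassen^⊗m, 7^m = n^2.807 at n = 2^m
⇒ c ≤ 1/log₂(8/7) ≈ 5.19; GM16 §4: Strassen^⊗2 = 1 + 6 + 6 + 36 under S_3² (4 orbits; 3 under S_3 ≀
S_2). ⟨3,3,3⟩: BILR rank-23 families,
orbit structure 1,2,4,4,12 under Z_4 × Z_3 (arXiv:1801.00843 §2); Burichenko arXiv:2211.06485:
length ≤ 22 ⇒ Aut(P) ↪ S_l × S_3 (Thm 2),
all terms invariant under one non-scalar isotropy ⇒ l ≥ 23 (Prop 5). Permutation cases: r ≥ n³ for
S_n³ (n ≥ 6, this route), r ≥ C(n,3)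
for diagonal S_n (n ≥ n₀; span rank 195/203). Modulation groups Z_n² with 1-bounded unit-weight
seeds: ≥ n^(1/2) orbits, rank ≥ n^2.5
(card symplectic-sqrt-cancellation-modulation-nogo, refuter-verified elementary form). ω(ℂ) < 2.3714
(laser method; H = 1, k = r).
Items at open: 10 (1 target, 4 cruxes, 4 support, 1 assembly).

DEFINITION REQUESTS. None now: matMulTensor, triad, tensorRank
(Literature.Computability.AlgebraicComplexity), Representation, Equiv.Perm, MonoidHom (Mathlib)
suffice and the design predicate is inlined. Foreseen at the first split: `IsOrbitDesign` /
`orbitDesignCost` under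
Summits/MatrixMultiplication/MatrixMultiplication/Theorems (sInf form of the least cost of a k-orbit
design), and a Literature cite fact for
Dixon–Mortimer Thm 5.2B (subgroups of S_n of index < C(n,r)) under Literature/GroupTheory if the
prover of DiagonalRelabellingCubic wants it as a hypothesis.

Novelty: Searches (2026-08-15): `lit search --source zbmath "matrix multiplication decomposition symmetry
group"` (13: arXiv:1610.08364 CILO,
arXiv:1911.07981 / doi:10.1017/fmp.2023.14 Conner–Harper–Landsberg, arXiv:1711.05796, ISSAC/STOC
volumes — no symmetric-class lower bound);
`lit search --source zbmath "Burichenko symmetry Strassen Laderman algorithm automorphism group"`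
(1: arXiv:1508.01110); `lit read
arxiv:1612.01527 --grep orbit|not optimal|irreducible` (§3 p.5 orbit sum annihilates non-trivial
irreps; §4 p.8: |G| = n³ − n, rank n³ − n + 1,
"not optimal", "we hope that similar constructions involving multiple orbits will yield optimal
decompositions", Strassen^⊗2 orbit
census 36+6+6+1); `lit read arxiv:2211.06485 --grep Theorem|Proposition|orbit` (Thm 2, Prop 5, Thm
8, Prop 9 read); `lit frontier
MatrixMultiplication --since 2022` (30 rows: arXiv:2602.11041 structure in decompositions,
arXiv:2606.13408 catalog, arXiv:2602.13171 — no
cost law for symmetric classes); the 140 idea cards of the sub (representation-stability-barrier: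
S_n-natural schemes ≥ C(n,3), the
195/203 span certificate reused in DiagonalRelabellingCubic; one-index-symmetry-splitting-law: exact
law for ONE-index abelian
symmetries; smith-theory-symmetric-algorithms, schur-weyl-equivariant-kronecker,
stabilizer-bilinear-complexity,
symplectic-sqrt-cancellation-modulation-nogo); the 11 route files of the sub. arXiv/S2/OpenAlex APIs
rate-limited (HTTP 429) and
`lit galaxy search "symmetric matrix multiplication  [refs: 10.1017/fmp.2023.14, 1610.08364, 1911.07981, 1711.05796, 1508.01110, 1612.01527, 2211.06485, 2602.11041, 2606.13408, 2602.13171, 1708.09398, 2002.06451, doi:10.1017/fmp.2023.14, arxiv:1612.01527, arxiv:2211.06485]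

Barriers (technique_class: orbit-designs, reynolds-operator, restricted-lower-bound): - technique_class: orbit-designs, reynolds-operator, restricted-lower-bound
- Literature.Barriers.MatrixMultiplication.LinearRankMethodBarrier: not in the class — no flattening
or determinantal equation is used; the bounds are for a RESTRICTED class of decompositions (cubic,
far above the 3n²-type caps) and claim nothing about R(⟨n,n,n⟩) itself; the tools are
permutation-group structure, invariant theory of the Reynolds image and character sums.
- Literature.Barriers.MatrixMultiplication.InfimumNotMinimumBarrier: the qualitative ancestor,
respected: CW82 says no single basic algorithm attains its exponent; the law says no bounded family
of seed ORBITS leaves exponent 3 − O(k/log n) — a statement about sequences of designs, consistent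
with (and sharper than) the barrier on its class; nothing here certifies an upper bound on ω.
- Literature.Barriers.MatrixMultiplication.IrreversibilityBarrier: not applicable — no intermediate
tensor, no degeneration; the objects are honest rank decompositions of ⟨n,n,n⟩ with symmetry.
- Literature.Barriers.MatrixMultiplication.UniversalMethodBarrier: not applicable for the same
reason (no fixed starting tensor, no monomial degeneration).
- Literature.Barriers.MatrixMultiplication.TricoloredSumFreeBarrier: orthogonal (slice-rank
obstruction to STPP hosts); noted only because the abelian TPP bound |S||T||U| ≤ |G| is exactly the
k = 1 law for regular modulation designs — a consistency check for AbelianDesignLaw, not an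
obstruction.
- Literature.Ba

History (route lifecycle, newest last):
- 2026-08-15T13:49:01Z · CLOSED retired — not-a-thesis: assembly does not conclude the sub-problem Statement (operator:999:1257524)

sub-problem: MatrixMultiplication · status: closed(retired) · opened planner-plancard-MatrixMultiplication-MatrixM-b1faef1f-0 2026-08-15T11:54:45Z · rev 1 · ledger route-MatrixMultiplication-OrbitEntropy
GENERATED by the gate from the ledger (D-0016/17). Provers cite these decls: `theorem foo : Summit.MatrixMultiplication.MatrixMultiplication.Theses.OrbitEntropy.<Decl> := …` in Summits/MatrixMultiplication/MatrixMultiplication/Theorems/<Name>.lean.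
-/

namespace Summit.MatrixMultiplication.MatrixMultiplication.Theses.OrbitEntropy

open scoped BigOperators Topology Manifold Classical MeasureTheory ProbabilityTheory Matrix InnerProductSpace ComplexConjugate ContinuousMap
open Filter Set Function TopologicalSpace MeasureTheory

/-- item stmt-MatrixMultiplication-6891 · target · rank 0 · closed · moot by None · by planner
why it might fail: false only if ONE fixed orbit budget k reaches exponent 2 + o(1) along a sequence of n — which would prove ω = 2 outright; conceivable solely via conjugation-type designs whose symmetry is free (GM16 §4 hopes), none known below n³ − n + 1.
sources: arXiv:1612.01527, arXiv:1708.09398, arXiv:2211.06485, Blaser2013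
[target] for every k there are δ > 0 and n₀ such that for all n ≥ n₀ every H-design of ⟨n,n,n⟩ (any
finite group H, any linear leg actions, equivariant labels) whose labels are covered by ≤ k seed
orbits has at least n^(2+δ) terms. Implied by ω(ℂ) > 2 (OmegaGtTwoFrame) and by OrbitSavingsLaw
(Assembly); its negation implies ω(ℂ) = 2. -/
def BoundedOrbitExponentGap : Prop :=
  ∀ k : ℕ, ∃ δ : ℝ, 0 < δ ∧ ∃ n₀ : ℕ, ∀ (n r : ℕ), n₀ ≤ n → ∀ (H : Type) [Group H] [Finite H] (ρA ρB ρC : Representation ℂ H (Fin n × Fin n → ℂ)) (π : H →* Equiv.Perm (Fin r)) (w u v : Fin r → Fin n × Fin n → ℂ), Literature.Computability.AlgebraicComplexity.matMulTensor ℂ n n n = ∑ j, Literature.Computability.AlgebraicComplexity.triad (w j) (u j) (v j) → (∀ (h : H) (j : Fin r), Literature.Computability.AlgebraicComplexity.triad (ρA h (w j)) (ρB h (u j)) (ρC h (v j)) = Literature.Computability.AlgebraicComplexity.triad (w (π h j)) (u (π h j)) (v (π h j))) → (∃ s : Fin k → Fin r, ∀ j : Fin r, ∃ (i : Fin k) (h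 : H), π h (s i) = j) → (n : ℝ) ^ (2 + δ) ≤ (r : ℝ)

/-- item stmt-MatrixMultiplication-6892 · crux · rank 2 · closed · moot by None · by planner
why it might fail: one bounded-orbit family with polynomial savings n^(3−δ) kills it — e.g. a multi-orbit conjugation design of the kind GM16 §4 hopes for, or a Clifford-orbit design at n = 2^m; even k = 2 below n³ − n + 1 is open for irreducible H.
sources: arXiv:1612.01527, arXiv:1708.09398, arXiv:2211.06485, arXiv:1801.00843, arXiv:1610.08364
[crux] the ORBIT–SAVINGS LAW (card item X / P3): there is an absolute c > 0 such that for every n,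
k, every finite group H and every H-design of ⟨n,n,n⟩ with ≤ k seed orbits, r ≥ n³·2^(−k/c)
(equivalently k ≥ c·log₂(n³/r): savings n^(3−δ) need ≥ c·δ·log₂ n seed orbits). Vacuous at H = 1 (k
= r); Strassen towers force c ≤ 1/log₂(8/7) ≈ 5.19 (StrassenTowerCalibration); the linear
formalisation (H → GL(A)×GL(B)×GL(C)) loses only a factor 6 in k against the full isotropy group
with its S_3 part. [difficulty: open-problem] -/
def OrbitSavingsLaw : Prop :=
  ∃ c : ℝ, 0 < c ∧ ∀ (n k r : ℕ) (H : Type) [Group H] [Finite H] (ρA ρB ρC : Representation ℂ H (Fin n × Fin n → ℂ)) (π : H →* Equiv.Perm (Fin r)) (w u v : Fin r → Fin n × Fin n → ℂ), Literature.Computability.AlgebraicComplexity.matMulTensor ℂ n n n = ∑ j, Literature.Computability.AlgebraicComplexity.triad (w j) (u j) (v j) → (∀ (h : H) (j : Fin r), Literature.Computability.AlgebraicComplexity.triad (ρA h (w j)) (ρB h (u j)) (ρC h (v j)) = Literature.Computability.AlgebraicComplexity.triad (w (π h j)) (u (π h j)) (v (π h j))) → (∃ s : Fin k → Fin r, ∀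 j : Fin r, ∃ (i : Fin k) (h : H), π h (s i) = j) → (n : ℝ) ^ 3 * (2 : ℝ) ^ (-(k : ℝ) / c) ≤ (r : ℝ)

/-- item stmt-MatrixMultiplication-6893 · crux · rank 3 · closed · moot by None · by planner
why it might fail: a seed of intermediate leg rank d with subspace stabilisers of index ~n/d in an irreducible G (monomial, S_(n+1), extraspecial at n = 2^m) could give a transitive G³-design of cost ~(n/d)³·(overhead) = o(n³); GM17 §4 proves optimality only inside the 2-design ansatz.
sources: arXiv:1612.01527, arXiv:1708.09398, arXiv:2211.06485
[crux] the first all-H case (the Grochow–Moore regime, card P3 at k ≤ 2): there is c > 0 such that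
every H-design of ⟨n,n,n⟩ (any finite H) whose labels are covered by at most two seed orbits has r ≥
c·n³. Data: standard algorithm k = 1, r = n³; GM16 §4: 1 + one orbit, r = n³ − n + 1 for all n;
Strassen 1 + 6 (c ≤ 7/8). Planner's remark (NOTES.md): transitive (k = 1) designs are PLENTIFUL —
for every finite irreducible G ≤ GL_n the G³-invariants of A⊗B⊗C are the line of ⟨n,n,n⟩ (Schur), so
the G³-orbit sum of ANY seed a⊗b⊗c with tr(abc) ≠ 0 is a multiple of ⟨n,n,n⟩ and, rescaled, a
one-orbit design of cost [G³ : Stab(seed)]; the crude bound [G : Stab_G(W)] ≥ n/dim W for subspace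
stabilisers gives r ≥ n³/(rk a · rk b · rk c) (so rank-one seeds never beat n³ and full-rank seeds
cost ≥ |G|² ≥ n⁴): the open regime is seeds of intermediate leg rank with large stabilisers, and
diagonal (non-product) H as in GM. Tools foreseen: leg-rank profiles are constant on orbits;
subspace-orbit counting; Jordan/Collins + Clifford theory to pass from H to a product-like normal
subgroup. [difficulty: L] -/
def TwoOrbitDesignsCubic : Prop :=
  ∃ c : ℝ, 0 < c ∧ ∀ (n r : ℕ) (H : Type) [Group H] [Finite H] (ρA ρB ρC : Representation ℂ H (Fin n × Fin n → ℂ)) (π : H →* Equiv.Perm (Fin r)) (w u v : Fin r → Fin n × Fin n → ℂ), Literature.Computability.AlgebraicComplexity.matMulTensor ℂ n n n = ∑ j, Literature.Computability.AlgebraicComplexity.triad (w j) (u j) (v j) → (∀ (h : H) (j : Fin r), Literature.Computability.AlgebraicComplexity.triad (ρA h (w j)) (ρB h (u j)) (ρC h (v j)) = Literature.Computability.AlgebraicComplexity.triad (w (π h j)) (u (π h j)) (v (π h j))) → (∃ s : Fin 2 → Fin r, ∀ j : Fin r, ∃ (i : Fin 2) (h : H), π h (s i) = j) → c * (n : ℝ)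 ^ 3 ≤ (r : ℝ)

/-- item stmt-MatrixMultiplication-6894 · crux · rank 4 · closed · moot by None · by planner
why it might fail: seeds with unbounded dynamic range escape every character-sum bound known (the modulation no-go needs 1-bounded unit-weight seeds); a bounded family of Bohr-set-supported seeds might tile the MaMu support with cancellation for H = Z_n² or a torsion torus.
sources: arXiv:2211.06485, arXiv:1612.01527, arXiv:math/0307321, arXiv:1207.6528
[crux] the law for ABELIAN H (card P2): there is c > 0 such that every design of ⟨n,n,n⟩ for a
finite abelian group H (torsion tori, modulation groups Z_n², cyclic groups; three commuting
diagonalisable leg actions) with ≤ k seed orbits has r ≥ n³·2^(−k/c). Mechanism: for abelian H the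
Reynolds image of a triad is its weight-zero part Σ_{λ+μ+ν=0} a_λ⊗b_μ⊗c_ν, so a k-seed design is an
additive covering of the MaMu support with cocycle phases by k sumset-shaped pieces; Burichenko's
cyclic-orbit reduction (arXiv:2211.06485 Prop 9) is the embryo, the op-norm/character-sum bound of
card symplectic-sqrt-cancellation-modulation-nogo (≥ n^(1/2) orbits for 1-bounded modulation seeds)
the first quantitative instance. [difficulty: L] -/
def AbelianDesignLaw : Prop :=
  ∃ c : ℝ, 0 < c ∧ ∀ (n k r : ℕ) (H : Type) [CommGroup H] [Finite H] (ρA ρB ρC : Representation ℂ H (Fin n × Fin n → ℂ)) (π : H →* Equiv.Perm (Fin r)) (w u v : Fin r → Fin n × Fin n → ℂ), Literature.Computability.AlgebraicComplexity.matMulTensor ℂ n n n = ∑ j, Literature.Computability.AlgebraicComplexity.triad (w j) (u j) (v j) → (∀ (h : H) (j : Fin r), Literature.Computability.AlgebraicComplexity.triad (ρA h (w j)) (ρB h (u j)) (ρC h (v j)) = Literature.Computability.AlgebraicComplexity.triad (w (π h j)) (u (π h j)) (v (π h j))) → (∃ s : Fin k → Fin r, ∀ j : Fin r, ∃ (i :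 Fin k) (h : H), π h (s i) = j) → (n : ℝ) ^ 3 * (2 : ℝ) ^ (-(k : ℝ) / c) ≤ (r : ℝ)

/-- item stmt-MatrixMultiplication-6895 · crux · rank 5 · closed · moot by None · by planner
why it might fail: the 195/203 span certificate is numeric at n = 50, 1000; a symbolic-n proof could expose sporadic n where the MaMu invariant enters the 2-label span (hence ∃ n₀), and Dixon–Mortimer 5.2B in Lean is a real formalisation project.
sources: doi:10.1007/978-1-4612-0731-3, arXiv:1204.4533, arXiv:1610.08364, arXiv:1801.00843
[crux] the CILO/BILR "standard symmetry" case (card P1): for n ≥ n₀ every decomposition of ⟨n,n,n⟩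
stable under simultaneous relabelling of all indices by S_n (σ acting diagonally on rows and columns
of all three legs, labels permuted by a hom π) has at least C(n,3) = n(n−1)(n−2)/6 terms — for every
orbit count k. Route: r < C(n,3) ⇒ every label stabiliser has index < C(n,3) in S_n ⇒ contains
Alt([n]∖Δ), |Δ| ≤ 2 (Dixon–Mortimer Thm 5.2B) ⇒ each leg is fixed by A_(n−2) (perfectness kills
characters) ⇒ legs lie in the 10-dimensional "≤ 2 labels" space ⇒ the terms lie in the span of
≤2-label orbit sums inside the 203-dimensional S_n-invariants of (ℂ^n)^⊗6, which misses the MaMu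
invariant x_{16|23|45}+… (span rank 195/203, certificate of card representation-stability-barrier,
exact at n = 50, 1000; symbolic-n version needed). [difficulty: M] -/
def DiagonalRelabellingCubic : Prop :=
  ∃ n₀ : ℕ, ∀ (n r : ℕ), n₀ ≤ n → ∀ (π : Equiv.Perm (Fin n) →* Equiv.Perm (Fin r)) (w u v : Fin r → Fin n × Fin n → ℂ), Literature.Computability.AlgebraicComplexity.matMulTensor ℂ n n n = ∑ j, Literature.Computability.AlgebraicComplexity.triad (w j) (u j) (v j) → (∀ (σ : Equiv.Perm (Fin n)) (j : Fin r) (a b c : Fin n × Fin n), Literature.Computability.AlgebraicComplexity.triad (w (π σ j)) (u (π σ j)) (v (π σ j)) (σ a.1, σ a.2) (σ b.1, σ b.2) (σ c.1, σ c.2) = Literature.Computability.AlgebraicComplexity.triad (w j) (u j) (v j) a b c) → Nat.choose n 3 ≤ r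

/-- item stmt-MatrixMultiplication-6896 · support · rank 9 · closed · moot by None · by planner
sources: Blaser2013, doi:10.1007/978-1-4612-0731-3, arXiv:1610.08364
[support] FULL index symmetry buys nothing: for n ≥ 6 every decomposition of ⟨n,n,n⟩ stable under
the whole index-permutation isotropy S_n × S_n × S_n ((σ,τ,υ) relabelling the row index i, the
summation index j and the column index k in all legs at once, labels permuted by a hom π) has at
least n³ terms (tight: the standard algorithm, StandardOneOrbit) — for every orbit count. Proof
(planner, NOTES.md): (a) LEMMA: G ≤ S_n³ of index < n³ contains a full alternating factor 1×A_n×1 in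
some coordinate (K_x := G ∩ factor_x is normal in G, so |G| ≤ |N(K_i)|·|N(K_j)|·|K_k|; if no K_x ⊇
A_n then two coordinates have N(K_x) ⊇ A_n, forcing K_x = 1, and G ∩ (S_n × S_n × 1) is a graph, so
[S_n³ : G] ≥ n! > n³); (b) r < n³ ⇒ each label stabiliser contains some 1×A_n(x)×1 ⇒ by equivariance
and 1-transitivity/perfectness of A_n the term is constant along index x in both legs carrying x ⇒
it is killed by the trilinear functional φ(X) = Σ ε(i,i′)ε(j,j′)ε(k,k′)·X((i,k),(i′,j),(j′,k′)),
ε(x,x′) = n[x=x′] − 1, whereas φ(⟨n,n,n⟩) = n³(n−1)³ ≠ 0. Uses alternatingGroup.isSimpleGroup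
(Mathlib). [difficulty: provable-now] -/
def IndexPermutationCubic : Prop :=
  ∀ (n r : ℕ), 6 ≤ n → ∀ (π : Equiv.Perm (Fin n) × Equiv.Perm (Fin n) × Equiv.Perm (Fin n) →* Equiv.Perm (Fin r)) (w u v : Fin r → Fin n × Fin n → ℂ), Literature.Computability.AlgebraicComplexity.matMulTensor ℂ n n n = ∑ j, Literature.Computability.AlgebraicComplexity.triad (w j) (u j) (v j) → (∀ (g : Equiv.Perm (Fin n) × Equiv.Perm (Fin n) × Equiv.Perm (Fin n)) (j : Fin r) (a b c : Fin n × Fin n), Literature.Computability.AlgebraicComplexity.triad (w (π g j)) (u (π g j)) (v (π g j)) (g.1 a.1, g.2.2 a.2) (g.1 b.1, g.2.1 b.2) (g.2.1 c.1, g.2.2 c.2) = Literature.Computability.AlgebraicComplexity.triad (w j) (u j) (v j) a b c) → n ^ 3 ≤ r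

/-- item stmt-MatrixMultiplication-6897 · support · rank 9 · closed · moot by None · by planner
sources: Blaser2013, arXiv:1612.01527
[support] calibration of the design predicate: the standard algorithm Σ_{i,j,k}
e_(i,k)⊗e_(i,j)⊗e_(j,k) is a ONE-orbit design under S_n × S_n × S_n (labels Fin (n³) ≃ triples
(i,j,k), permuted coordinatewise), so IndexPermutationCubic is tight and OrbitSavingsLaw needs
2^(−1/c) ≤ 1 only. [difficulty: provable-now] -/
def StandardOneOrbit : Prop :=
  ∀ n : ℕ, ∃ (π : Equiv.Perm (Fin n) × Equiv.Perm (Fin n) × Equiv.Perm (Fin n) →* Equiv.Perm (Fin (n ^ 3))) (w u v : Fin (n ^ 3) → Fin n × Fin n → ℂ), Literature.Computability.AlgebraicComplexity.matMulTensor ℂ n n n = ∑ j, Literature.Computability.AlgebraicComplexity.triad (w j) (u j) (v j) ∧ (∀ (g : Equiv.Perm (Fin n) × Equiv.Perm (Fin n) × Equiv.Perm (Fin n)) (j : Fin (n ^ 3)) (a b c : Fin n × Fin n), Literature.Computability.AlgebraicComplexity.triad (w (π g j)) (u (π g j)) (v (π g j)) (g.1 a.1, g.2.2 a.2) (g.1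 b.1, g.2.1 b.2) (g.2.1 c.1, g.2.2 c.2) = Literature.Computability.AlgebraicComplexity.triad (w j) (u j) (v j) a b c) ∧ ∀ j j' : Fin (n ^ 3), ∃ g : Equiv.Perm (Fin n) × Equiv.Perm (Fin n) × Equiv.Perm (Fin n), π g j = j'

/-- item stmt-MatrixMultiplication-6898 · support · rank 9 · closed · moot by None · by planner
sources: Strassen1969, arXiv:1708.09398, arXiv:1612.01527, arXiv:1408.6273
[support] calibration from above (the law is sharp in SHAPE): for every m the m-th Kronecker power
of Strassen's decomposition, in the Grochow–Moore form 1 + one S_3-orbit of six terms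
(arXiv:1708.09398), is a design of ⟨2^m,2^m,2^m⟩ with 7^m terms and at most m+1 seed orbits under
the finite group S_3 ≀ S_m (S_3 by simultaneous conjugation in each Kronecker slot, S_m permuting
slots) — the orbit of a term is its number of identity slots. Consequence: any admissible c in
OrbitSavingsLaw satisfies 8^m·2^(−(m+1)/c) ≤ 7^m for all m, i.e. c ≤ 1/log₂(8/7) ≈ 5.19.
[difficulty: M] -/
def StrassenTowerCalibration : Prop :=
  ∀ m : ℕ, ∃ (H : Type) (_ : Group H) (_ : Finite H) (ρA ρB ρC : Representation ℂ H (Fin (2 ^ m) × Fin (2 ^ m) → ℂ)) (π : H →* Equiv.Perm (Fin (7 ^ m))) (w u v : Fin (7 ^ m) → Fin (2 ^ m) × Fin (2 ^ m) → ℂ), Literature.Computability.AlgebraicComplexity.matMulTensor ℂ (2 ^ m) (2 ^ m) (2 ^ m) = ∑ j, Literature.Computability.AlgebraicComplexity.triad (w j) (u j) (v j) ∧ (∀ (h : H) (j : Fin (7 ^ m)), Literature.Computability.AlgebraicComplexity.triad (ρA h (w j)) (ρB h (u j)) (ρC h (v j)) = Literature.Computability.AlgebraicComplexity.triad (w (π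 h j)) (u (π h j)) (v (π h j))) ∧ ∃ s : Fin (m + 1) → Fin (7 ^ m), ∀ j : Fin (7 ^ m), ∃ (i : Fin (m + 1)) (h : H), π h (s i) = j

/-- item stmt-MatrixMultiplication-6899 · support · rank 9 · closed · moot by None · by planner
sources: Blaser2013, arXiv:1612.01527
[support] the frame recording that the target is an instance family of the NEGATIVE summit: if ω(ℂ)
≠ 2 then (two_le_omega) ω(ℂ) = 2 + δ with δ > 0, and every design is in particular a decomposition,
so r ≥ R(⟨n,n,n⟩) ≥ n^ω (rpow_omega_le_tensorRank_matMulTensor, n ≥ 2) = n^(2+δ):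
¬MatrixMultiplication → BoundedOrbitExponentGap, uniformly in k. PROVED in the planner's Sketch.lean
(sorry-free); its contrapositive says a bounded-orbit family of exponent 2 would prove the summit.
[difficulty: provable-now] -/
def OmegaGtTwoFrame : Prop :=
  ¬ MatrixMultiplication → BoundedOrbitExponentGap

/-- item stmt-MatrixMultiplication-6900 · assembly · rank 1 · closed · moot by None · by planner
sources: arXiv:1612.01527, Blaser2013
[assembly] OrbitSavingsLaw → BoundedOrbitExponentGap (the target; ¬MatrixMultiplication →
BoundedOrbitExponentGap is the separately filed frame OmegaGtTwoFrame). -/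
def Assembly : Prop :=
  OrbitSavingsLaw → BoundedOrbitExponentGap

end Summit.MatrixMultiplication.MatrixMultiplication.Theses.OrbitEntropy
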